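import Literature.Analysis.FluidPDE.NavierStokesReynolds
import Literature.Analysis.FluidPDE.MixedNormSmooth
import HarnessLib

/-!
# The two steps of the Cheskidov–Luo iteration (Props. 3.1 and 4.1) and their assembly into Prop. 2.2

A. Cheskidov, X. Luo, *Sharp nonuniqueness for the Navier–Stokes equations*, Invent. Math. 229
(2022) 987–1054 = arXiv:2009.06596 (numbering of the held arXiv copy), prove their main iteration
proposition (Prop. 2.2, the accepted named fact `Torus.CheskidovLuo2022MainIteration` of
`Literature.Analysis.FluidPDE.NavierStokesReynolds`) in two steps (§2, "Step 1 / Step 2"; §2.5: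
"We will break down Proposition 2.2 into two separate propositions, whose proof will be the
context of Section 3 and respectively Section 4 and Section 5"):

* **Step 1, concentrating the stress error** (Prop. 3.1, §3): a tiny corrector, obtained by
  solving the generalised Navier–Stokes system linearised around `(u, R)` exactly on
  `∼ τ^{-ε}` short sub-intervals and gluing with sharp cut-offs, moves the Reynolds stress onto a
  set `I` of `≤ τ^{-ε}` intervals of length `5τ`, at the cost of a factor `C(r, ε)` in
  `L¹_t L^r_x`;
* **Step 2, space–time convex integration** (Prop. 4.1, §§4–5): intermittent-in-time stationary
  Mikado flows reduce the concentrated stress below `δ` in `L¹_t L^r_x`, with a velocity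
  perturbation supported in `I × 𝕋^d`, of size `‖R̄‖_{L¹_{t,x}}^{1/2}` in `L²_{t,x}` and `≤ δ` in
  `L^p_t L^∞_x`;

and then (§4, after Prop. 4.1): "It is clear that Proposition 2.2 follows from Proposition 3.1
and Proposition 4.1."

This file vendors the two steps as named facts, in the vocabulary of the parent fact
(`Torus.IsNSReynoldsOn`, `Torus.IsWellPrepared`, `Torus.eLqLpNorm`), and PROVES the quoted
assembly:

* `Torus.CheskidovLuo2022Concentration` — Prop. 3.1 (named fact, `def … : Prop`);
* `Torus.CheskidovLuo2022ConvexIntegration` — Prop. 4.1 (named fact, `def … : Prop`);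
* `Torus.CheskidovLuo2022MainIteration_of_steps` (proved):
  `CheskidovLuo2022Concentration → CheskidovLuo2022ConvexIntegration → CheskidovLuo2022MainIteration`.

The assembly is the bookkeeping the paper leaves to the reader: Step 1 is run with a smallness
`δ₁ = min (δ / (2 max(1,T)), ‖R‖_{L¹Lʳ}^{1/2} / max(1,T))` of the corrector, Step 2 with `δ/2`;
Minkowski's inequality in `L²_{t,x}` and in `L^p_t L^∞_x`, `L¹_x ≤ L^r_x` on the torus and
`‖R̄‖_{L¹Lʳ} ≤ C ‖R‖_{L¹Lʳ}` give the constants `M = M₄.₁ C^{1/2} + 1` and `r = r₄.₁`; when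
`‖R‖_{L¹(0,T;Lʳ)} = 0` the stress vanishes identically (smoothness) and the step is the identity
with `I = ∅`. The analytic lemmas this needs on the mixed norms of jointly smooth fields
(continuity in time of slice norms, Minkowski, monotonicity in the space exponent, finiteness,
`‖w‖ = 0 ⇒ w ≡ 0`) are the proved [folklore] lemmas of
`Literature.Analysis.FluidPDE.MixedNormSmooth`.

## Rendering of the two steps (read against the printed statements)

Both steps are printed for `T = 1` ("without loss of generality", §2.5) and rendered on `[0, T]`,
`T > 0`, exactly as the parent fact; `0 < ε < 1`; smooth solutions of (2.1) are
`Torus.IsNSReynoldsOn (Icc 0 T) 1` triples with zero-mean velocity (standing convention, §1.1);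
well-preparedness is `Torus.IsWellPrepared` (Def. 2.1); `‖·‖_{L^q(0,T;L^p)}` is `Torus.eLqLpNorm q p
· (Ioo 0 T)` (stress measured in the column-sup pointwise norm of the parent file). As in the
parent fact, every `W^{1,q}` / `H^d` clause is either dropped or replaced by a WEAKER sup-norm
clause (no `W^{k,q}(𝕋^d)` vocabulary in the tree), and two clauses are stated in the form the
printed PROOF delivers (documented at each def):

* Prop. 3.1: the smallness `‖w̄‖_{L^∞(0,1;H^d)} ≤ δ` of the corrector is rendered by the weaker
  pointwise bound `‖ū(t,x) - u(t,x)‖ ≤ δ` on `[0,T] × 𝕋^d` (`H^d(𝕋^d) ⊂ L^∞`, constant absorbed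
  in the arbitrary `δ`); `Supp w̄ ⊂ Ĩ × 𝕋^d` (closed `Ĩ`) is `ū(t) = u(t)` for `t ∈ [0,T] ∖ Ĩ`;
  the clause `ū(0) = u(0)` is added from the construction ((3.2): `vᵢ(tᵢ) = 0`, `t₀ = 0`,
  `χ₀ = 1` near `0`), being what §2.6 uses ("`uₙ(0,x) ≡ v(0,x)` for all `n ≥ 1`").
* Prop. 4.1: the hypothesis "`(ū, R̄)` … given by Proposition 3.1 for the set `I` and time scale
  `τ`" is rendered by what §§4–5 use of it: a smooth zero-mean well-prepared solution for `(I, τ)`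
  whose stress vanishes whenever `dist(t, Iᶜ) ≤ 3τ/2` (the input of the temporal cut-off `θ` of §4.3);
  the `L²` clause is rendered with the square root its proof gives (Props. 5.3–5.5:
  `‖w^{(p)}‖_{L²_{t,x}} ≲ ‖R̄‖_{L¹_{t,x}}^{1/2} + C_u σ^{-1/2}`, `‖w^{(c)}‖, ‖w^{(t)}‖ ≤ ‖R̄‖^{1/2}`),
  exactly as the parent fact does; `Supp w ⊂ I × 𝕋^d` is `u₁(t) = ū(t)` for `t ∈ [0,T] ∖ I`.

What is NOT here: the proofs of the two steps (§3: local well-posedness of the generalised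
Navier–Stokes system in `H^d` and a Calderón–Zygmund estimate for `ℛ`, Props. 3.2–3.3; §§4–5 and
App. B: geometric lemma 4.2, Mikado flows Thm. 4.3, the perturbation of §4.4, Lemmas
4.4–4.6, 5.1–5.2, Props. 5.3–5.5, Lemmas 5.6–5.8, improved Hölder Lemma 7.1, antidivergences
Def. 7.2 / Thms. 7.3–7.4) — none of this machinery exists in Mathlib at this pin.

## Mathlib / tree search

Mathlib (this pin) has no Navier–Stokes, Reynolds-stress or convex-integration notions (searched
`Reynolds`, `Mikado`, `NavierStokes`: only this library). In tree: the parent vocabulary of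
`Literature.Analysis.FluidPDE.NavierStokesReynolds`; a proved Nash lemma for `3 × 3` matrices near
the identity (`Literature.Analysis.FluidPDE.CP25.nash_lemma`, the `d = 3` case of Lemma 4.2's
device); no antidivergence operator `ℛ` beyond the existence fact
`Torus.exists_smooth_antidivergence`. Used from Mathlib: `eLpNorm` monotonicity/rpow API,
`ENNReal.mul_rpow_of_nonneg`, `ENNReal.ofReal_rpow_of_nonneg`.

## References

* A. Cheskidov, X. Luo, *Sharp nonuniqueness for the Navier–Stokes equations*, Invent. Math. 229
  (2022), 987–1054; arXiv:2009.06596: Def. 2.1, Prop. 2.2, §2.5, Prop. 3.1, §3.3, Prop. 4.1 and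
  the sentence following it, Lemma 4.6, Props. 5.3–5.5. [`CheskidovLuo2022`]
-/

open MeasureTheory Set Topology Filter
open scoped InnerProductSpace ContDiff ENNReal NNReal

noncomputable section

namespace Literature.Analysis.FluidPDE

namespace Torus

variable {d : Type*} [Fintype d]

/-! ## The two steps as named facts -/

section Steps

variable [DecidableEq d]

/-- **Cheskidov–Luo 2022, Prop. 3.1 (concentrating the stress error), named fact — in the form its
proof delivers.** Printed (for `T = 1`, viscosity `1`, `d ≥ 2`): "Let `0 < ε < 1` and `(u, R)` be a
well-prepared smooth solution of (2.1) for some set `Ĩ` and a length scale `τ̃ > 0`. For any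
`1 < r < ∞`, there exists a universal constant `C = C(r, ε) > 0` such that the following holds. For
any `δ > 0`, there exists another well-prepared smooth solution `(ū, R̄)` of (2.1) for some set
`I ⊂ Ĩ` with `0, 1 ∉ I` and `τ < τ̃/2` satisfying the following. (1) The new stress error `R̄`
satisfies `R̄(t, x) = 0` if `dist(t, Iᶜ) ≤ 3τ/2`, and `‖R̄‖_{L¹(0,1;Lʳ(𝕋^d))} ≤ C ‖R‖_{L¹(0,1;Lʳ(𝕋^d))}`;
(2) the velocity perturbation `w̄ := ū - u` satisfies `Supp w̄ ⊂ Ĩ × 𝕋^d` and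
`‖w̄‖_{L^∞(0,1;H^d(𝕋^d))} ≤ δ`."
**Rendering** (as for the parent `Torus.CheskidovLuo2022MainIteration`): `card d ≥ 2`; time
interval `[0, T]`, `T > 0` (print `T = 1` w.l.o.g., §2.5); `C` is chosen after `T, ε, r` and
before `δ` and `(u, R)`, i.e. it depends on `(T, ε, r)` only — the printed "universal constant
`C = C(r, ε)`" (§3: "a universal constant that only depends on `r` and `ε > 0` in the
well-preparedness"; the sentence introducing `(u, R)` precedes it in print, but "universal"
excludes dependence on `(u, R)`), with a `T`-dependence allowed by the rendering on `[0, T]`; smooth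
solutions are `Torus.IsNSReynoldsOn (Icc 0 T) 1` triples with zero-mean velocity (standing
convention §1.1, "`ū` has zero spatial mean", §3.2); well-preparedness is `Torus.IsWellPrepared`
(Def. 2.1); `Supp w̄ ⊂ Ĩ × 𝕋^d` (`Ĩ` closed) is rendered as `ū(t) = u(t)` for `t ∈ [0,T] ∖ Ĩ`;
the `H^d`-smallness is rendered by the WEAKER pointwise bound `‖ū(t,x) - u(t,x)‖ ≤ δ` on
`[0,T] × 𝕋^d` (`H^d(𝕋^d) ↪ L^∞`, the embedding constant absorbed in the arbitrary `δ`). **One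
clause is added from the construction (§§3.1–3.2), not printed in Prop. 3.1:** `ū(0) = u(0)` —
`ū = u + ∑ᵢ χᵢ vᵢ` with `vᵢ(tᵢ) = 0` in (3.2) and `t₀ = 0`, so `w̄(0) = χ₀(0) v₀(0) = 0`; this is
what the proof of Thm. 1.7 uses (§2.6: "`uₙ(0, x) ≡ v(0, x)` for all `n ≥ 1`"), cf. the same
clause in the parent fact. The proof (§3: local well-posedness of the generalised Navier–Stokes
system (3.2) in `H^d` on intervals of length `τ^ε`, Prop. 3.2, the sharp gluing of §3.2, the
`L¹_t Lʳ_x` bound Prop. 3.3 via the Calderón–Zygmund estimate for `ℛ`, and §3.3) is not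
formalised. [cite: CheskidovLuo2022, Prop. 3.1] -/
def CheskidovLuo2022Concentration : Prop :=
  2 ≤ Fintype.card d → ∀ (T : ℝ), 0 < T → ∀ (ε : ℝ), 0 < ε → ε < 1 → ∀ (r : ℝ), 1 < r →
    ∃ C : ℝ, 0 < C ∧ ∀ (δ : ℝ), 0 < δ →
      ∀ (u : ℝ → UnitAddTorus d → EuclideanSpace ℝ d) (P : ℝ → UnitAddTorus d → ℝ)
        (R : ℝ → UnitAddTorus d → d → EuclideanSpace ℝ d) (I₀ : Set ℝ) (τ₀ : ℝ),
        IsNSReynoldsOn (Icc 0 T) 1 u P R → (∀ t ∈ Icc 0 T, FunctionSpaces.Torus.HasZeroMean (u t)) →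
        IsWellPrepared T ε R I₀ τ₀ →
        ∃ (u₁ : ℝ → UnitAddTorus d → EuclideanSpace ℝ d) (P₁ : ℝ → UnitAddTorus d → ℝ)
          (R₁ : ℝ → UnitAddTorus d → d → EuclideanSpace ℝ d) (I : Set ℝ) (τ : ℝ),
          IsNSReynoldsOn (Icc 0 T) 1 u₁ P₁ R₁ ∧ (∀ t ∈ Icc 0 T, FunctionSpaces.Torus.HasZeroMean (u₁ t)) ∧
          IsWellPrepared T ε R₁ I τ ∧ I ⊆ I₀ ∧ (0 : ℝ) ∉ I ∧ T ∉ I ∧ τ < τ₀ / 2 ∧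
          (∀ t ∈ Icc 0 T, Metric.infDist t Iᶜ ≤ 3 * τ / 2 → ∀ x, R₁ t x = 0) ∧
          eLqLpNorm 1 (ENNReal.ofReal r) R₁ (Ioo 0 T) ≤
            ENNReal.ofReal C * eLqLpNorm 1 (ENNReal.ofReal r) R (Ioo 0 T) ∧
          (∀ t ∈ Icc 0 T, t ∉ I₀ → u₁ t = u t) ∧ u₁ 0 = u 0 ∧
          (∀ t ∈ Icc 0 T, ∀ x, ‖u₁ t x - u t x‖ ≤ δ)

/-- **Cheskidov–Luo 2022, Prop. 4.1 (the convex-integration step), named fact — in the form its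
proof delivers.** Printed (for `T = 1`, viscosity `1`, `d ≥ 2`): "There exists a universal constant
`M > 0` such that for any `p < 2` and `q < ∞`, there exists `r > 1` depending only on `p` and `q`
such that the following holds. Let `δ > 0` and `(ū, R̄)` be a well-prepared smooth solution of (2.1)
given by Proposition 3.1 for the set `I` and time scale `τ`. Then there exists another well-prepared
smooth solution `(u₁, R₁)` of (2.1) for the same set `I` and time scale `τ` such that
`‖R₁‖_{L¹(0,1;Lʳ(𝕋^d))} ≤ δ`. Moreover, the velocity perturbation `w := u₁ - ū` satisfies
(1) `Supp w ⊂ I × 𝕋^d`; (2) `‖w‖_{L²([0,1] × 𝕋^d)} ≤ M ‖R̄‖_{L¹([0,1] × 𝕋^d)}`;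
(3) `‖w‖_{L^p(0,1;L^∞(𝕋^d))} + ‖w‖_{L¹(0,1;W^{1,q}(𝕋^d))} ≤ δ`."
**Rendering** (as for the parent `Torus.CheskidovLuo2022MainIteration`): `card d ≥ 2`; `[0, T]`,
`T > 0`, `0 < ε < 1`, `1 ≤ p < 2`; `M` is chosen after `T, ε` and before `p` (print: universal),
`r` after `p`; the hypothesis "given by Proposition 3.1 for the set `I` and time scale `τ`" is
rendered by exactly what §§4–5 use of it — `(ū, R̄)` is a `Torus.IsNSReynoldsOn (Icc 0 T) 1`
triple with zero-mean velocity, well-prepared for `(I, τ)` (`Torus.IsWellPrepared`, Def. 2.1), and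
`R̄(t) = 0` whenever `dist(t, Iᶜ) ≤ 3τ/2` (Prop. 3.1 (1); this is what makes the cut-off `θ` of
§4.3 satisfy `Supp R̄ ⊂ {θ = 1}`, Lemma 4.4); the `W^{1,q}` half of (3) is not rendered (no
`W^{1,q}(𝕋^d)` vocabulary; dropping a conclusion weakens the fact), so `q` disappears and `r`
depends on `p` (and `d`); `Supp w ⊂ I × 𝕋^d` (`I` closed) is rendered as `u₁(t) = ū(t)` for
`t ∈ [0,T] ∖ I` (Lemma 4.6). **The `L²` clause (2) is stated as proved in §5 rather than as
printed:** Props. 5.3–5.5 give `‖w^{(p)}‖_{L²_{t,x}} ≲ ‖R̄‖_{L¹_{t,x}}^{1/2} + C_u σ^{-1/2}`,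
`‖w^{(c)}‖_{L²_{t,x}}, ‖w^{(t)}‖_{L²_{t,x}} ≤ ‖R̄‖_{L¹_{t,x}}^{1/2}` for `λ` large, i.e. a SQUARE
ROOT, `‖u₁ - ū‖_{L²(0,T;L²)} ≤ M ‖R̄‖_{L¹(0,T;L¹)}^{1/2}` — the form the parent fact uses (its
docstring, correction (2)); for `R̄ ≡ 0` the clause forces `w = 0` a.e., where `u₁ = ū` is
admissible. (Note for a future discharge: with the divisor `ρ = χ(R̄) ≥ 1` of §4.3 the bound
`∫ρ(t,x) dx ≲ ‖R̄(t)‖_{L¹}` invoked in the proof of Prop. 5.3 fails for small `R̄(t)`; keeping the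
cut-off `θ` (supported in `I`) and a floor `ρ = γ χ(R̄/γ)`, `γ > 0` small, gives
`‖w‖²_{L²_{t,x}} ≲ ‖R̄‖_{L¹_{t,x}} + γ|I| + C_{u,γ} (ν⁻¹ + σ^{-1/2})`, hence (2) as rendered.) The
stress is measured in the column-sup pointwise norm of `Torus.IsEulerReynoldsOn`
(all matrix norms are equivalent; constants absorbed in `M`, `r`, `δ`). The proof (§4: geometric
Lemma 4.2, stationary Mikado flows Thm. 4.3, the intermittent oscillations `g_κ`, `h_κ` of §4.2,
the perturbation `w = w^{(p)} + w^{(c)} + w^{(t)}` of §4.4, the new stress Lemmas 4.5–4.6;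
§5: choice of parameters Lemma 5.1, estimates Lemma 5.2, Props. 5.3–5.5, Lemmas 5.6–5.8; App. B:
improved Hölder inequality and the antidivergences `ℛ`, `ℬ`) is not formalised.
[cite: CheskidovLuo2022, Prop. 4.1] -/
def CheskidovLuo2022ConvexIntegration : Prop :=
  2 ≤ Fintype.card d → ∀ (T : ℝ), 0 < T → ∀ (ε : ℝ), 0 < ε → ε < 1 →
    ∃ M : ℝ, 0 < M ∧ ∀ (p : ℝ), 1 ≤ p → p < 2 → ∃ r : ℝ, 1 < r ∧ ∀ (δ : ℝ), 0 < δ →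
      ∀ (u : ℝ → UnitAddTorus d → EuclideanSpace ℝ d) (P : ℝ → UnitAddTorus d → ℝ)
        (R : ℝ → UnitAddTorus d → d → EuclideanSpace ℝ d) (I : Set ℝ) (τ : ℝ),
        IsNSReynoldsOn (Icc 0 T) 1 u P R → (∀ t ∈ Icc 0 T, FunctionSpaces.Torus.HasZeroMean (u t)) →
        IsWellPrepared T ε R I τ → (∀ t ∈ Icc 0 T, Metric.infDist t Iᶜ ≤ 3 * τ / 2 → ∀ x, R t x = 0) →
        ∃ (u₁ : ℝ → UnitAddTorus d → EuclideanSpace ℝ d) (P₁ : ℝ → UnitAddTorus d → ℝ)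
          (R₁ : ℝ → UnitAddTorus d → d → EuclideanSpace ℝ d),
          IsNSReynoldsOn (Icc 0 T) 1 u₁ P₁ R₁ ∧ (∀ t ∈ Icc 0 T, FunctionSpaces.Torus.HasZeroMean (u₁ t)) ∧
          IsWellPrepared T ε R₁ I τ ∧
          eLqLpNorm 1 (ENNReal.ofReal r) R₁ (Ioo 0 T) ≤ ENNReal.ofReal δ ∧
          (∀ t ∈ Icc 0 T, t ∉ I → u₁ t = u t) ∧
          eLqLpNorm 2 2 (fun t x => u₁ t x - u t x) (Ioo 0 T) ≤
            ENNReal.ofReal M * eLqLpNorm 1 1 R (Ioo 0 T) ^ (1 / 2 : ℝ) ∧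
          eLqLpNorm (ENNReal.ofReal p) ⊤ (fun t x => u₁ t x - u t x) (Ioo 0 T) ≤ ENNReal.ofReal δ

end Steps

/-! ## Assembly: Prop. 3.1 and Prop. 4.1 imply Prop. 2.2 -/

section Assembly

variable [DecidableEq d]

omit [Fintype d] [DecidableEq d] in
/-- The identity step is well-prepared with the EMPTY set of intervals at any positive scale, as
soon as the stress vanishes identically on `[0, T]` (Def. 2.1 with zero intervals). [cite: CheskidovLuo2022, Def. 2.1] -/
theorem isWellPrepared_empty {T ε τ : ℝ} (hT : 0 ≤ T) (hτ : 0 < τ)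
    {R : ℝ → UnitAddTorus d → d → EuclideanSpace ℝ d} (hR : ∀ t ∈ Icc 0 T, ∀ x, R t x = 0) :
    IsWellPrepared T ε R ∅ τ where
  pos := hτ
  exists_finset := ⟨∅, by simpa using Real.rpow_nonneg (by positivity) ε, by simp⟩
  stress_eq_zero t ht _ x := hR t ht x

/-- **Cheskidov–Luo 2022, Prop. 2.2 from Prop. 3.1 and Prop. 4.1** (§4, after Prop. 4.1: "It is
clear that Proposition 2.2 follows from Proposition 3.1 and Proposition 4.1"), for the renderings
`Torus.CheskidovLuo2022Concentration`, `Torus.CheskidovLuo2022ConvexIntegration` and the parent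
`Torus.CheskidovLuo2022MainIteration`. Proof: given `T, ε, p`, take `M₂` and `r` from Prop. 4.1 and
`C = C(r, ε)` from Prop. 3.1, and put `M := M₂ C^{1/2} + 1`. Given `δ` and a well-prepared
`(u, R)` for `(I₀, τ₀)` with `N := ‖R‖_{L¹(0,T;Lʳ)}`: if `N = 0` then `R ≡ 0` on `[0,T]`
(smoothness, `eq_zero_of_eLqLpNorm_eq_zero`) and `(u, R)` itself, with `I = ∅`, `τ = τ₀/4`, is the
required output. Otherwise run Prop. 3.1 with corrector size
`δ₁ := min (δ / (2 max(1,T))) (N^{1/2} / max(1,T))` and Prop. 4.1 on its output with `δ/2`: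
the output is well-prepared for `I ⊆ I₀` with `0, T ∉ I`, `τ < τ₀/2`, `‖R₁‖_{L¹Lʳ} ≤ δ/2`;
`u₁ = ū` off `I ⊉ {0}` and `ū = u` off `I₀` give `u₁ = u` off `I₀` and `u₁(0) = u(0)`; Minkowski
(`eLqLpNorm_add_le_of_smooth`) with `‖ū - u‖_{L^qL^p} ≤ max(1,T) δ₁`
(`eLqLpNorm_le_of_forall_norm_le`) gives `‖u₁ - u‖_{L^pL^∞} ≤ δ/2 + δ/2` and
`‖u₁ - u‖_{L²L²} ≤ M₂ ‖R̄‖_{L¹L¹}^{1/2} + N^{1/2} ≤ M₂ (C N)^{1/2} + N^{1/2} = M N^{1/2}`, using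
`L¹_x ≤ Lʳ_x` on the torus (`eLqLpNorm_mono_exponent_of_smooth`) and `‖R̄‖_{L¹Lʳ} ≤ C N`.
[cite: CheskidovLuo2022, Prop. 2.2 and §4 (sentence after Prop. 4.1)] -/
theorem CheskidovLuo2022MainIteration_of_steps (h₁ : CheskidovLuo2022Concentration (d := d))
    (h₂ : CheskidovLuo2022ConvexIntegration (d := d)) : CheskidovLuo2022MainIteration (d := d) := by
  intro hd T hT ε hε hε1 p hp1 hp2
  obtain ⟨M₂, hM₂, hstep₂⟩ := h₂ hd T hT ε hε hε1
  obtain ⟨r, hr, hstep₂⟩ := hstep₂ p hp1 hp2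
  obtain ⟨C, hC, hstep₁⟩ := h₁ hd T hT ε hε hε1 r hr
  refine ⟨M₂ * Real.sqrt C + 1, by positivity, r, hr, ?_⟩
  intro δ hδ u P R I₀ τ₀ hsol hmean hwp
  have hr1 : (1 : ℝ≥0∞) ≤ ENNReal.ofReal r := ENNReal.one_le_ofReal.2 hr.le
  have hp1' : (1 : ℝ≥0∞) ≤ ENNReal.ofReal p := ENNReal.one_le_ofReal.2 hp1
  set N : ℝ≥0∞ := eLqLpNorm 1 (ENNReal.ofReal r) R (Ioo 0 T) with hN
  have hNtop : N < ⊤ := hsol.smooth_stress.eLqLpNorm_lt_top le_rfl _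
  rcases eq_or_ne N 0 with hN0 | hN0
  · -- `R ≡ 0`: the identity step with `I = ∅`, `τ = τ₀ / 4`
    have hR0 : ∀ t ∈ Icc 0 T, ∀ x, R t x = 0 :=
      eq_zero_of_eLqLpNorm_eq_zero hsol.smooth_stress hT one_ne_zero hr1 hN0
    have hzero : (fun t x => u t x - u t x) = (0 : ℝ → UnitAddTorus d → EuclideanSpace ℝ d) := by
      funext t x; simp
    refine ⟨u, P, R, ∅, τ₀ / 4, hsol, hmean, isWellPrepared_empty hT.le (by linarith [hwp.pos]) hR0,
      empty_subset _, fun h => h, fun h => h, by linarith [hwp.pos], ?_, fun t _ _ => rfl, rfl, ?_, ?_⟩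
    · exact hN0.le.trans bot_le
    · rw [hzero, eLqLpNorm, FluidPDE.eLqLpNorm_zero]; exact bot_le
    · rw [hzero, eLqLpNorm, FluidPDE.eLqLpNorm_zero]; exact bot_le
  -- `N > 0`: run the two steps
  have hNpos : 0 < N.toReal := ENNReal.toReal_pos hN0 hNtop.ne
  have hmax : 0 < max 1 T := lt_max_of_lt_left zero_lt_one
  set δ₁ : ℝ := min (δ / (2 * max 1 T)) (Real.sqrt N.toReal / max 1 T) with hδ₁
  have hδ₁pos : 0 < δ₁ := lt_min (by positivity) (div_pos (Real.sqrt_pos.2 hNpos) hmax)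
  obtain ⟨ub, Pb, Rb, I, τ, hsol₁, hmean₁, hwp₁, hII₀, h0I, hTI, hτ, hvan₁, hle₁, hoff₁, hinit₁, hsmall₁⟩ :=
    hstep₁ δ₁ hδ₁pos u P R I₀ τ₀ hsol hmean hwp
  obtain ⟨u₁, P₁, R₁, hsol₂, hmean₂, hwp₂, hle₂, hoff₂, hL2₂, hLp₂⟩ :=
    hstep₂ (δ / 2) (half_pos hδ) ub Pb Rb I τ hsol₁ hmean₁ hwp₁ hvan₁
  -- smoothness of the two increments and the splitting `u₁ - u = (u₁ - ub) + (ub - u)`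
  have hwA : FunctionSpaces.Torus.IsSmoothSpaceTimeOn (Icc 0 T) (fun t x => u₁ t x - ub t x) :=
    hsol₂.smooth_velocity.sub hsol₁.smooth_velocity
  have hwB : FunctionSpaces.Torus.IsSmoothSpaceTimeOn (Icc 0 T) (fun t x => ub t x - u t x) :=
    hsol₁.smooth_velocity.sub hsol.smooth_velocity
  have hsplit : (fun t x => u₁ t x - u t x) = fun t x => (u₁ t x - ub t x) + (ub t x - u t x) := by
    funext t x; abel
  -- the corrector `ub - u` is small in every mixed norm
  have hBsmall : ∀ {q : ℝ≥0∞} (_ : 1 ≤ q) (p' : ℝ≥0∞),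
      eLqLpNorm q p' (fun t x => ub t x - u t x) (Ioo 0 T) ≤ ENNReal.ofReal (max 1 T * δ₁) :=
    fun hq p' => eLqLpNorm_le_of_forall_norm_le hδ₁pos.le hq p'
      fun t ht x => hsmall₁ t (Ioo_subset_Icc_self ht) x
  have hB1 : max 1 T * δ₁ ≤ δ / 2 := by
    calc max 1 T * δ₁ ≤ max 1 T * (δ / (2 * max 1 T)) := by gcongr; exact min_le_left _ _
      _ = δ / 2 := by field_simp
  have hB2 : max 1 T * δ₁ ≤ Real.sqrt N.toReal := by
    calc max 1 T * δ₁ ≤ max 1 T * (Real.sqrt N.toReal / max 1 T) := by gcongr; exact min_le_right _ _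
      _ = Real.sqrt N.toReal := by field_simp
  have hsqrtN : ENNReal.ofReal (Real.sqrt N.toReal) = N ^ (1 / 2 : ℝ) := by
    rw [Real.sqrt_eq_rpow, ENNReal.toReal_rpow,
      ENNReal.ofReal_toReal (ENNReal.rpow_ne_top_of_nonneg (by norm_num) hNtop.ne)]
  refine ⟨u₁, P₁, R₁, I, τ, hsol₂, hmean₂, hwp₂, hII₀, h0I, hTI, hτ, ?_, ?_, ?_, ?_, ?_⟩
  · -- `‖R₁‖_{L¹Lʳ} ≤ δ/2 ≤ δ`
    exact hle₂.trans (ENNReal.ofReal_le_ofReal (by linarith))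
  · -- `u₁ = u` off `I₀`
    intro t ht htI₀
    exact (hoff₂ t ht fun h => htI₀ (hII₀ h)).trans (hoff₁ t ht htI₀)
  · -- `u₁ 0 = u 0`
    exact (hoff₂ 0 ⟨le_rfl, hT.le⟩ h0I).trans hinit₁
  · -- the `L²L²` estimate
    have hRbar : eLqLpNorm 1 1 Rb (Ioo 0 T) ≤ ENNReal.ofReal C * N :=
      (eLqLpNorm_mono_exponent_of_smooth hsol₁.smooth_stress 1 hr1).trans hle₁
    have hhalf : (0 : ℝ) ≤ 1 / 2 := by norm_num
    have hA : eLqLpNorm 2 2 (fun t x => u₁ t x - ub t x) (Ioo 0 T) ≤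
        ENNReal.ofReal M₂ * (ENNReal.ofReal C * N) ^ (1 / 2 : ℝ) :=
      hL2₂.trans (mul_le_mul_right (ENNReal.rpow_le_rpow hRbar hhalf) _)
    have hB : eLqLpNorm 2 2 (fun t x => ub t x - u t x) (Ioo 0 T) ≤ N ^ (1 / 2 : ℝ) := by
      rw [← hsqrtN]
      exact (hBsmall one_le_two 2).trans (ENNReal.ofReal_le_ofReal hB2)
    have hM : ENNReal.ofReal M₂ * (ENNReal.ofReal C * N) ^ (1 / 2 : ℝ) + N ^ (1 / 2 : ℝ) =
        ENNReal.ofReal (M₂ * Real.sqrt C + 1) * N ^ (1 / 2 : ℝ) := by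
      rw [ENNReal.mul_rpow_of_nonneg _ _ hhalf, ENNReal.ofReal_add (by positivity) zero_le_one,
        ENNReal.ofReal_one, add_mul, one_mul, ENNReal.ofReal_mul hM₂.le, Real.sqrt_eq_rpow,
        ← ENNReal.ofReal_rpow_of_nonneg hC.le hhalf, mul_assoc]
    calc eLqLpNorm 2 2 (fun t x => u₁ t x - u t x) (Ioo 0 T)
        ≤ eLqLpNorm 2 2 (fun t x => u₁ t x - ub t x) (Ioo 0 T) +
            eLqLpNorm 2 2 (fun t x => ub t x - u t x) (Ioo 0 T) := by
          rw [hsplit]; exact eLqLpNorm_add_le_of_smooth hwA hwB one_le_two one_le_two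
      _ ≤ ENNReal.ofReal M₂ * (ENNReal.ofReal C * N) ^ (1 / 2 : ℝ) + N ^ (1 / 2 : ℝ) :=
          add_le_add hA hB
      _ = ENNReal.ofReal (M₂ * Real.sqrt C + 1) * N ^ (1 / 2 : ℝ) := hM
  · -- the `L^pL^∞` estimate
    have hB : eLqLpNorm (ENNReal.ofReal p) ⊤ (fun t x => ub t x - u t x) (Ioo 0 T) ≤
        ENNReal.ofReal (δ / 2) :=
      (hBsmall hp1' ⊤).trans (ENNReal.ofReal_le_ofReal hB1)
    calc eLqLpNorm (ENNReal.ofReal p) ⊤ (fun t x => u₁ t x - u t x) (Ioo 0 T)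
        ≤ eLqLpNorm (ENNReal.ofReal p) ⊤ (fun t x => u₁ t x - ub t x) (Ioo 0 T) +
            eLqLpNorm (ENNReal.ofReal p) ⊤ (fun t x => ub t x - u t x) (Ioo 0 T) := by
          rw [hsplit]; exact eLqLpNorm_add_le_of_smooth hwA hwB hp1' le_top
      _ ≤ ENNReal.ofReal (δ / 2) + ENNReal.ofReal (δ / 2) := add_le_add hLp₂ hB
      _ = ENNReal.ofReal δ := by
          rw [← ENNReal.ofReal_add (by positivity) (by positivity), add_halves]

end Assembly

end Torus

end Literature.Analysis.FluidPDE
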